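import Summits.BirchSwinnertonDyer.BirchSwinnertonDyer.Theses.FrozenTwin
import Summits.BirchSwinnertonDyer.BirchSwinnertonDyer.Theorems.TangentConeSelmerRankSmallImageReduction

/-!
# BirchSwinnertonDyer / FrozenTwin — the Serre prime supply (`SerrePrimeSupply`)

Route `FrozenTwin`, support item `stmt-BirchSwinnertonDyer-17959` (`SerrePrimeSupply`): every
elliptic curve over `ℚ` WITHOUT complex multiplication, given by a globally minimal Weierstrass
equation `W`, has a prime `p ≥ 5` of good ORDINARY reduction (`p ∤ a_p(W)`) at which the mod-`p`
Galois representation `ρ̄_{E,p}` is surjective.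

Mathematically this is Serre's open image theorem (Serre 1972, §4.2 Thm 2: for a non-CM curve
`ρ̄_{E,p}` is surjective for all `p ≥ p₀(E)`) combined with the infinitude of good ordinary primes
(Serre 1981, §8). Both ingredients are discharged in the tree
(`Literature.NumberTheory.EllipticCurves.serre_open_image_holds`,
`WeierstrassCurve.infinite_goodOrdinaryPrimes_holds`), and their combination is already the tree
theorem `Summit.BirchSwinnertonDyer.BirchSwinnertonDyer.Theorems.exists_goodOrdinary_surjective_of_not_hasCM`
(`Theorems/TangentConeSelmerRankSmallImageReduction.lean`), whose statement is the route decl with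
the binders introduced. This file only transports that theorem to the route decl; it is the "prime
switch" hypothesis of the route's deciding theorem `FrozenTwin.closes` (non-CM curves are sent to a
big-image good ordinary prime, CM curves to the crux `SelmerRankCM`).

Nothing else is here: no new definitions, no named-fact hypotheses (the result is unconditional).
-/

-- single-conjunct summit: `Summit.BirchSwinnertonDyer.BirchSwinnertonDyer.…` repeats the name by design
set_option linter.dupNamespace false

namespace Summit.BirchSwinnertonDyer.BirchSwinnertonDyer.Theorems

/-- Settles `stmt-BirchSwinnertonDyer-17959` (support of route FrozenTwin, `SerrePrimeSupply`):
for every elliptic curve over `ℚ` in globally minimal Weierstrass form `W` without complex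
multiplication there is a prime `p ≥ 5` with `W.HasGoodReductionAtPrime p`,
`¬ (p : ℤ) ∣ W.frobeniusTrace p` (ordinary) and `W.HasSurjectiveModNGaloisRep p` (surjective
mod-`p` image). Immediate from the tree theorem `exists_goodOrdinary_surjective_of_not_hasCM`
(Serre's open image theorem + infinitely many good ordinary primes).
[cite: Serre1972, §4.2 Thm 2] -/
theorem frozenTwin_serrePrimeSupply_proof :
    Summit.BirchSwinnertonDyer.BirchSwinnertonDyer.Theses.FrozenTwin.SerrePrimeSupply := by
  unfold Summit.BirchSwinnertonDyer.BirchSwinnertonDyer.Theses.FrozenTwin.SerrePrimeSupply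
  intro W _ _ hW
  exact exists_goodOrdinary_surjective_of_not_hasCM W hW

end Summit.BirchSwinnertonDyer.BirchSwinnertonDyer.Theorems
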